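import Literature.Analysis.FluidPDE.KNSSLiouville
import Literature.Analysis.FluidPDE.KatoSymmetryCovariance
import HarnessLib

/-!
# Space translation of bounded weak Navier–Stokes solutions (KNSS 2009, §4 (ii))

Analysis/FluidPDE support file (all results proved). The class of bounded weak solutions of
Koch–Nadirashvili–Seregin–Šverák (`IsBoundedWeakNSSolutionOn`, `KNSSLiouville`; Acta Math. 203
(2009) = arXiv:0709.3599, §4 (ii)) is invariant under time translations
(`IsBoundedWeakNSSolutionOn.comp_add_right`, `KNSSRegularityGluing`); this file proves its
invariance under **space translations**, `u ↦ u(t, a + ·)`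
(`IsBoundedWeakNSSolutionOn.comp_add_space`): measurability and the bound transport along the
measure-preserving map `(t, y) ↦ (t, a + y)`, weak divergence-freeness of the slices is
`IsWeaklyDivFree.comp_sub_right` (`KatoSymmetryCovariance`), and a divergence-free test field
`ψ` on the slab is tested against `u(t, a + ·)` by testing `ψ(t, · − a)` (the pull-back
`stPull 1 1 0 (−a) ψ` of `SpaceTimeRescaling`, with its chain rules) against `u` and translating
the space integral (Mathlib `integral_sub_right_eq_self`).

This is the covariance needed to apply the §4 regularity of the tree (stated about the
coordinate axis, e.g. `KNSS2009_regularity_boundedWeak_window.lipschitz_of_cylRadius_bound`) to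
fields axisymmetric about a translated axis, as in Step 5 of the proof of Theorem 6.2
(decomposition `KNSSTypeIRateCore`, ingredient `KNSS2009_typeI_rate_compactness`).

## References

* G. Koch, N. Nadirashvili, G. Seregin, V. Šverák, Acta Math. 203 (2009) = arXiv:0709.3599,
  §4 (ii), p. 8. [KochNadirashviliSereginSverak2009]
-/

noncomputable section

open MeasureTheory Set Function Filter TopologicalSpace InnerProductSpace
open scoped RealInnerProductSpace Laplacian

namespace Literature.Analysis.FluidPDE

variable {E : Type*} [NormedAddCommGroup E] [InnerProductSpace ℝ E] [FiniteDimensional ℝ E]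
  [MeasurableSpace E] [BorelSpace E]

omit [MeasurableSpace E] [BorelSpace E] [FiniteDimensional ℝ E] in
/-- The slab `I × E` is invariant under the space translation `(s, y) ↦ (s, −a + y)`. [folklore] -/
theorem stPreimage_one_one_zero_slab (a : E) (I : Set ℝ) (hI : IsOpen I) :
    stPreimage 1 1 0 (-a) (slab E I hI) = slab E I hI := by
  ext z
  change stAffine 1 1 0 (-a) z ∈ (slab E I hI : Set (ℝ × E)) ↔ z ∈ (slab E I hI : Set (ℝ × E))
  rw [SetLike.mem_coe, SetLike.mem_coe, mem_slab, mem_slab, stAffine_fst]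
  simp

/-- **Space translation of bounded weak solutions** (KNSS 2009, §4 (ii): the class of bounded
weak solutions on `ℝⁿ × I` is invariant under `x ↦ x + a`). If `u` is a bounded weak solution
on the open time set `I` with viscosity `ν`, so is `(t, y) ↦ u(t, a + y)`, for every `a`. [folklore] -/
theorem IsBoundedWeakNSSolutionOn.comp_add_space {I : Set ℝ} {hI : IsOpen I} {ν : ℝ}
    {u : ℝ → E → E} (h : IsBoundedWeakNSSolutionOn I hI ν u) (a : E) :
    IsBoundedWeakNSSolutionOn I hI ν (fun t y => u t (a + y)) := by
  obtain ⟨hmeas, ⟨C, hC⟩, hdiv, hweak⟩ := h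
  refine ⟨?_, ⟨C, fun t ht y => hC t ht (a + y)⟩, ?_, fun ψ hψ hψdiv => ?_⟩
  · -- measurability on the slab, along `(t, y) ↦ (t, a + y)`
    have he : MeasurePreserving (Prod.map (id : ℝ → ℝ) (fun y : E => a + y))
        (volume : Measure (ℝ × E)) volume := by
      have := (MeasurePreserving.id (volume : Measure ℝ)).prod
        (measurePreserving_add_left (volume : Measure E) a)
      rwa [← Measure.volume_eq_prod] at this
    have hpre : (Prod.map (id : ℝ → ℝ) (fun y : E => a + y)) ⁻¹' (I ×ˢ (univ : Set E)) =
        I ×ˢ univ := by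
      ext p
      simp
    have he' := he.restrict_preimage (hI.measurableSet.prod MeasurableSet.univ)
    rw [hpre] at he'
    exact hmeas.comp_measurePreserving he'
  · -- divergence constraint for a.e. time
    filter_upwards [hdiv] with t ht
    have h1 := ht.comp_sub_right (-a)
    have e : (fun y => u t (y - -a)) = fun y => u t (a + y) := by
      funext y
      rw [sub_neg_eq_add, add_comm]
    rwa [e] at h1
  · -- the weak identity: test `ψ(t, · − a)` against `u`
    set φ : ℝ → E → E := stPull 1 1 0 (-a) ψ with hφ_def
    have hφ : IsSpaceTimeTestOn (slab E I hI) φ := by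
      have := hψ.stPull one_ne_zero one_ne_zero 0 (-a)
      rwa [stPreimage_one_one_zero_slab] at this
    have hφt : ∀ t x, φ t x = ψ t (x - a) := fun t x => by
      simp [hφ_def, stPull_apply, neg_add_eq_sub]
    have hφdiv : ∀ t, VectorCalculus.IsDivFree (φ t) := by
      intro t x
      rw [hφ_def, divergence_stPull, one_mul]
      simpa [neg_add_eq_sub] using hψdiv t (-a + (1 : ℝ) • x)
    have key := hweak φ hφ hφdiv
    -- the chain rules, at the point `x`, relate `φ` at `x` to `ψ` at `x - a`
    have htd : ∀ t x, timeDeriv φ t x = timeDeriv ψ t (x - a) := by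
      intro t x
      rw [hφ_def, timeDeriv_stPull]
      simp [neg_add_eq_sub]
    have hfd : ∀ t x, fderiv ℝ (φ t) x = fderiv ℝ (ψ t) (x - a) := by
      intro t x
      rw [hφ_def, fderiv_stPull]
      simp [neg_add_eq_sub]
    have hlap : ∀ t x, (Δ (φ t)) x = (Δ (ψ t)) (x - a) := by
      intro t x
      have h2 : ContDiff ℝ 2 (ψ (0 + 1 * t)) := hψ.contDiff_slice_two _
      rw [hφ_def, laplacian_stPull 1 1 0 (-a) ψ t x h2]
      simp [neg_add_eq_sub]
    -- translate the space integral at each time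
    have hG : ∀ t, (∫ y, (⟪u t (a + y), timeDeriv ψ t y⟫ +
        ⟪u t (a + y), convect (fun y => u t (a + y)) (ψ t) y⟫ + ν * ⟪u t (a + y), Δ (ψ t) y⟫)) =
        ∫ x, (⟪u t x, timeDeriv φ t x⟫ + ⟪u t x, convect (u t) (φ t) x⟫ +
          ν * ⟪u t x, Δ (φ t) x⟫) := by
      intro t
      have e := integral_sub_right_eq_self (μ := (volume : Measure E))
        (fun y => ⟪u t (a + y), timeDeriv ψ t y⟫ +
          ⟪u t (a + y), convect (fun y => u t (a + y)) (ψ t) y⟫ + ν * ⟪u t (a + y), Δ (ψ t) y⟫)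
        a
      rw [← e]
      refine integral_congr_ae (Eventually.of_forall fun x => ?_)
      simp only [convect_apply, htd, hfd, hlap, add_sub_cancel]
    calc ∫ t in I, ∫ y, (⟪u t (a + y), timeDeriv ψ t y⟫ +
          ⟪u t (a + y), convect (fun y => u t (a + y)) (ψ t) y⟫ + ν * ⟪u t (a + y), Δ (ψ t) y⟫)
        = ∫ t in I, ∫ x, (⟪u t x, timeDeriv φ t x⟫ + ⟪u t x, convect (u t) (φ t) x⟫ +
            ν * ⟪u t x, Δ (φ t) x⟫) := setIntegral_congr_fun hI.measurableSet fun t _ => hG t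
      _ = 0 := key

end Literature.Analysis.FluidPDE

end
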